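import Mathlib

/-!
# EriceRemainderEnclosureHistoryAutonomyComparisonAgeComposition — (E71a) COMPARISON COMPOSES OVER AGE GROUPS: the first-order comparison system of a profile
# split into an OLD part and a YOUNG part, `ε = e − K_O ε − K_y ε` (triangular in the depth), has the EXACT finite expansion
# `(I + K_O + K_y)⁻¹ = Σ_i (R_y R_O K_O K_y)^i R_y R_O` (`R_• = (I + K_•)⁻¹`; the supports shrink by two depths per round), and therefore
# POSITIVITY COMPOSES: if the old system maps a class `A ∋ e` of inputs to NON-NEGATIVE outputs that are SUPERSOLUTIONS of the young kernel (KEY: «old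
# surplus at the pin ≥ young reads of the old surplus over the young window») and the old reads of the young drops return to `A` (MONO), then the full
# solution is non-negative and at least the old-first factorisation `R_y R_O e`; a LONE AGE (kernel rows of mass `≤ 1`) maps non-increasing inputs to
# `[0, input]` — the base of an induction over the ages of a profile, youngest added last

Cell `pub-balaban`, β-function sub-cell, BINDER row D4 «RemainderConst leaves for Bałaban's split» (`HOME/BINDER-OWNERS.md`; owner lineage `b2b-balaban-beta-an4`;
this file by co-owner #2 lineage `b2b-balaban-beta-d4-p2`, generation 62), β-FLOW TEAM duty (1), FREEZE (0) honoured (def-free; Mathlib only; nothing restated).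
Sequel of (E70c) `…ComparisonRenewalPositivity` (same abstract renewal language: a kernel `K n l ≥ 0` reading the lags `l + 1`, `l < N`, below the pin `n`).

HONEST FRAMING (page 1, verbatim and binding).  *"Discharging BetaPertH makes Bałaban's UV stability UNCONDITIONAL — a real constructive-QFT result; it is
NOT the continuum limit and NOT the Clay problem."*  THIS FILE DISCHARGES NOTHING OF THE KIND.  Elementary linear algebra about ABSTRACT real sequences and
triangular systems — hypotheses of a census, not facts; the form, signs, ages and moments of Bałaban's (1.22) limit functional are NOT PRINTED ([I] p. 298;
GAPS G-t4-U2-1∕-2) and NOT asserted.  Row D4 class UNCHANGED (critical-path width 0; instance 0∕1; D4 DISCHARGE NO DATE).  HONEST DEPENDENCY: continuum YM on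
T⁴ ⇐ BetaPertH ∧ nine spine estimates (0/9 proved); BetaPertH ⇐ (D1) ∧ (D4) ∧ CAP+tail; G-an2-4 gates asym, D1 and NE2/3/4.

THE POINT (census sense (α); the COMPARISON column, conjecture (E58′); a route TRANSVERSE to the budgeted certificates (E65)–(E70) and to the depth
inductions of (E70c)∕(E70e): INDUCTION OVER THE AGES OF THE PROFILE).  Along the base orbit the exact first-order STEP system is `ε_n = e_n − Σ_{l≥1}
K̃_n(l) ε_{n+l}` with the damped tail-sum kernel `K̃_n(l) = Σ_{k≥l} (L_k h_{n+k}³∕2)·Π_{i=n+l}^{n+k} g_i` (`g_i = 1∕(1+f_i)` the pin damping; README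
`HOME/b2b-balaban-beta-d4-p2/g60/e70/README.md` §PS), and the kernel is ADDITIVE OVER THE AGES: `K̃ = Σ_k K̃^{(k)}`, `K̃^{(k)}_n(l) = [l ≤ k]·(L_k h_{n+k}³∕2)·Π g`
(common damping).  Split the ages into the YOUNGEST `y` and the OLDER ones `O`: `K = K_O + K_y`.  §3 proves the EXACT IDENTITY (finite Neumann expansion,
no smallness) `ε = Σ_{i ≤ N} T_i`, `T_i = R_y R_O W_i`, `W_0 = e`, `W_{i+1} = K_O K_y T_i` — matrix form `(I+K_O+K_y)⁻¹ = Σ_i (R_yR_OK_OK_y)^i R_yR_O`, from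
`(I+K_O)(I+K_y) = I + K + K_OK_y` — and the COMPOSITION PRINCIPLE: every term is `≥ 0` as soon as (P_O) `R_O` is non-negative on a class `A ∋ e` of inputs,
(KEY) its outputs `v` are SUPERSOLUTIONS of the young kernel, `K_y v ≤ v` (then `0 ≤ R_y v ≤ v` by §2 — the lone young age needs nothing but the sign of its
kernel), and (MONO) `K_OK_y(R_yv) ∈ A`.  With `A` = «non-negative, non-increasing in the depth» (§4) and the lone-age base (§2 `sol_nonneg_le_of_antitone`:
rows of mass `Σ_l K̃^{(k)}_n(l) ≤ x_k(z_n) ≤ √2∕2 < 1` by (E62a)'s acceleration lemma) this is the induction step «comparison for `O` ⟹ comparison for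
`O ∪ {y}`», youngest age added last — the algebraic form of g54's observation that far blocks compose MULTIPLICATIVELY (each block eats a fraction of the
effective excess left by the older ones): the old system is solved FIRST and its surplus is the young age's excess.  NUMERICS of record (pure python,
`HOME/b2b-balaban-beta-d4-p2/g62/numerics/`, `t6.py`–`t11.py`; towers R = 2 (H ≤ 8), R = 3, 4, Fibonacci ages, clusters {2..7}, {5..10}, {8..12}, Markov
weight, 3–8 ages, random and ADVERSARIAL coupling ratios over 4 decades, every truncation depth of the excess): EVERY Neumann term is non-negative (0
exceptions in > 10⁴ terms), the series reproduces `ε` to 1e-16, the inputs `W_i` are non-increasing in the depth (MONO, 0 exceptions), and the KEY ratio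
`(K_y v)_n∕v_n` over all outputs `v = R_O W_i`, pins and truncations is ≤ 0.546 — its supremum is attained at the TRIVIAL old system (`v` flat, ratio = the
lone damped load of `y`): loading the old ages LOWERS the ratio (budget competition beats the rise of the old surplus over the young window).  So the
route's single remaining obligation is the KEY LEMMA «`R_O e ≥ K_y R_O e` for every flow, every `O`, every younger `y`» with a margin ≈ 0.45 (against 0.04 in
the ratio-3 cells of (E67)–(E69)); README `HOME/b2b-balaban-beta-d4-p2/g62/e71/README.md` records why positivity of the old system alone cannot give it
(the old surplus may be exponentially small in the number of far blocks while flat over the young window: KEY is a HARNACK-type statement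
`v_{n+l} ≤ v_n∕x̃_y(z_n)`, `l ≤ y`, about the outputs of `R_O`).  NOT CLAIMED: KEY or MONO for the flow; (E58′); anything nonlinear; anything printed.

WHAT IS PROVED ([folklore]; 0 `def`, 0 sorry; hypotheses display the read operators `R v n = Σ_{l<N} K n l·v(n+1+l)` and the zero-tailed triangular
solution operators `S w = w − R (S w)` as data).  §1 `read_eq_zero_of_tail`, `read_le_read`, `read_nonneg`, `read_sub`, `read_sum`.  §2 `sol_eq_zero_of_tail`
(supports), **`sol_unique`**, **`sol_nonneg_le_of_supersol`** (`0 ≤ S v ≤ v` for a supersolution `v ≥ K v ≥ 0`), `read_le_self_of_antitone`,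
**`sol_nonneg_le_of_antitone`** (LONE AGE: rows of mass `≤ 1`, non-increasing input).  §3 `read_add`, **`eq_sum_of_age_composition`** (the exact expansion),
**`nonneg_of_age_composition`** (positivity composes; lower bound by the old-first factorisation `S_y (S_O e) ≤ ε`).  §4 **`nonneg_of_age_composition_antitone`**
(the class of non-increasing inputs: P_O + KEY + MONO ⟹ positivity).
-/
noncomputable section
open Finset

namespace Summit.QuantumFields.BalabanUV.Beta.EriceRemainderEnclosureHistoryAutonomyComparisonAgeComposition

variable {N : ℕ} {K KO Ky : ℕ → ℕ → ℝ} {R RO Ry S SO Sy : (ℕ → ℝ) → ℕ → ℝ}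

/-! ## §1 Reads: vanishing beyond the support, monotonicity, positivity, linearity -/

/-- A READ `R v n = Σ_{l<N} K n l · v (n+1+l)` of a sequence vanishing at the depths `n` with `N < n + c` vanishes at the depths with `N < n + (c + 1)`
(reads look strictly deeper). [folklore] -/
theorem read_eq_zero_of_tail (hR : ∀ v n, R v n = ∑ l ∈ range N, K n l * v (n + 1 + l)) {v : ℕ → ℝ} {c : ℕ}
    (hv : ∀ n, N < n + c → v n = 0) : ∀ n, N < n + (c + 1) → R v n = 0 := by
  intro n hn
  rw [hR]
  exact sum_eq_zero fun l _ => by rw [hv (n + 1 + l) (by omega), mul_zero]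

/-- Reads by a non-negative kernel are monotone in the deeper values. [folklore] -/
theorem read_le_read (hR : ∀ v n, R v n = ∑ l ∈ range N, K n l * v (n + 1 + l)) (hK : ∀ n l, 0 ≤ K n l)
    {t v : ℕ → ℝ} {n : ℕ} (htv : ∀ m, n < m → t m ≤ v m) : R t n ≤ R v n := by
  rw [hR, hR]
  exact sum_le_sum fun l _ => mul_le_mul_of_nonneg_left (htv _ (by omega)) (hK n l)

/-- Reads by a non-negative kernel of a sequence non-negative below the pin are non-negative. [folklore] -/
theorem read_nonneg (hR : ∀ v n, R v n = ∑ l ∈ range N, K n l * v (n + 1 + l)) (hK : ∀ n l, 0 ≤ K n l)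
    {t : ℕ → ℝ} {n : ℕ} (ht : ∀ m, n < m → 0 ≤ t m) : 0 ≤ R t n := by
  rw [hR]
  exact sum_nonneg fun l _ => mul_nonneg (hK n l) (ht _ (by omega))

/-- Reads are additive under subtraction. [folklore] -/
theorem read_sub (hR : ∀ v n, R v n = ∑ l ∈ range N, K n l * v (n + 1 + l)) (u v : ℕ → ℝ) (n : ℕ) :
    R (fun m => u m - v m) n = R u n - R v n := by
  rw [hR, hR, hR, ← sum_sub_distrib]
  exact sum_congr rfl fun l _ => by ring

/-- Reads commute with finite sums. [folklore] -/
theorem read_sum (hR : ∀ v n, R v n = ∑ l ∈ range N, K n l * v (n + 1 + l)) (s : Finset ℕ) (f : ℕ → ℕ → ℝ) (n : ℕ) :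
    R (fun m => ∑ i ∈ s, f i m) n = ∑ i ∈ s, R (f i) n := by
  rw [hR]
  simp_rw [hR, mul_sum]
  rw [sum_comm]

/-! ## §2 Triangular renewal solutions on a horizon: support, uniqueness, supersolutions -/

/-- **SUPPORT.**  The solution `t` (zero beyond the horizon `N`, `t n = w n − R t n` for every `n`) of a triangular renewal system whose input vanishes
at the depths `n` with `N < n + c` vanishes there too. [folklore] -/
theorem sol_eq_zero_of_tail (hR : ∀ v n, R v n = ∑ l ∈ range N, K n l * v (n + 1 + l)) {w t : ℕ → ℝ} {c : ℕ}
    (htail : ∀ n, N < n → t n = 0) (hrec : ∀ n, t n = w n - R t n) (hw : ∀ n, N < n + c → w n = 0) :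
    ∀ n, N < n + c → t n = 0 := by
  suffices h : ∀ d n, N < n + c → N < n + d → t n = 0 from fun n hn => h (N + 1) n hn (by omega)
  intro d
  induction d with
  | zero => intro n _ hN; exact htail n (by simpa using hN)
  | succ d ih =>
    intro n hc hN
    by_cases hNn : N < n
    · exact htail n hNn
    rw [hrec n, hw n hc, hR]
    simp only [zero_sub, neg_eq_zero]
    exact sum_eq_zero fun l _ => by rw [ih (n + 1 + l) (by omega) (by omega), mul_zero]

/-- **UNIQUENESS.**  Two solutions with zero tails beyond the horizon coincide. [folklore] -/
theorem sol_unique (hR : ∀ v n, R v n = ∑ l ∈ range N, K n l * v (n + 1 + l)) {w t u : ℕ → ℝ}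
    (ht : ∀ n, N < n → t n = 0) (htrec : ∀ n, t n = w n - R t n) (hu : ∀ n, N < n → u n = 0) (hurec : ∀ n, u n = w n - R u n) :
    ∀ n, t n = u n := by
  suffices h : ∀ d n, N < n + d → t n = u n from fun n => h (N + 1) n (by omega)
  intro d
  induction d with
  | zero => intro n hN; rw [ht n (by simpa using hN), hu n (by simpa using hN)]
  | succ d ih =>
    intro n hN
    by_cases hNn : N < n
    · rw [ht n hNn, hu n hNn]
    rw [htrec n, hurec n, hR, hR]
    congr 1
    exact sum_congr rfl fun l _ => by rw [ih (n + 1 + l) (by omega)]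

/-- **SUPERSOLUTIONS DOMINATE.**  Non-negative kernel; `v ≥ 0` with zero tail and `R v ≤ v` at every pin (a SUPERSOLUTION); `t` the solution with input `v`
(`t n = v n − R t n`, zero tail).  Then `0 ≤ t ≤ v` at every depth: downward induction, `t n = v n − R t n ≥ v n − R v n ≥ 0` by `t ≤ v` deeper, and
`t n ≤ v n` by `t ≥ 0` deeper. [folklore] -/
theorem sol_nonneg_le_of_supersol (hR : ∀ v n, R v n = ∑ l ∈ range N, K n l * v (n + 1 + l)) (hK : ∀ n l, 0 ≤ K n l)
    {v t : ℕ → ℝ} (hv0 : ∀ n, 0 ≤ v n) (hsup : ∀ n, R v n ≤ v n)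
    (htail : ∀ n, N < n → t n = 0) (hrec : ∀ n, t n = v n - R t n) :
    ∀ n, 0 ≤ t n ∧ t n ≤ v n := by
  suffices h : ∀ d n, N < n + d → 0 ≤ t n ∧ t n ≤ v n from fun n => h (N + 1) n (by omega)
  intro d
  induction d with
  | zero => intro n hN; rw [htail n (by simpa using hN)]; exact ⟨le_rfl, hv0 n⟩
  | succ d ih =>
    intro n hN
    by_cases hNn : N < n
    · rw [htail n hNn]; exact ⟨le_rfl, hv0 n⟩
    have hdeep : ∀ m, n < m → 0 ≤ t m ∧ t m ≤ v m := fun m hm => ih m (by omega)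
    have h1 : R t n ≤ R v n := read_le_read hR hK fun m hm => (hdeep m hm).2
    have h2 : 0 ≤ R t n := read_nonneg hR hK fun m hm => (hdeep m hm).1
    rw [hrec n]
    exact ⟨by linarith [hsup n], by linarith⟩

/-- A non-increasing non-negative sequence is a supersolution of every non-negative kernel whose rows sum to at most `1` (a LONE AGE: the damped load).
[folklore] -/
theorem read_le_self_of_antitone (hR : ∀ v n, R v n = ∑ l ∈ range N, K n l * v (n + 1 + l)) (hK : ∀ n l, 0 ≤ K n l)
    (hrow : ∀ n, ∑ l ∈ range N, K n l ≤ 1) {w : ℕ → ℝ} (hw0 : ∀ n, 0 ≤ w n) (hanti : ∀ n, w (n + 1) ≤ w n) (n : ℕ) :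
    R w n ≤ w n := by
  have hmono : ∀ m k, w (m + k) ≤ w m := fun m k => by
    induction k with
    | zero => simp
    | succ k ih => exact (by rw [← add_assoc]; exact hanti _ : w (m + (k + 1)) ≤ w (m + k)).trans ih
  rw [hR]
  calc ∑ l ∈ range N, K n l * w (n + 1 + l) ≤ ∑ l ∈ range N, K n l * w n :=
        sum_le_sum fun l _ => mul_le_mul_of_nonneg_left (by rw [add_assoc]; exact hmono n (1 + l)) (hK n l)
    _ = (∑ l ∈ range N, K n l) * w n := by rw [sum_mul]
    _ ≤ 1 * w n := mul_le_mul_of_nonneg_right (hrow n) (hw0 n)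
    _ = w n := one_mul _

/-- **LONE AGE.**  The solution of a triangular renewal system with a non-negative kernel of row sums `≤ 1` and a NON-INCREASING non-negative input (zero
beyond the horizon) is non-negative and below the input. [folklore] -/
theorem sol_nonneg_le_of_antitone (hR : ∀ v n, R v n = ∑ l ∈ range N, K n l * v (n + 1 + l)) (hK : ∀ n l, 0 ≤ K n l)
    (hrow : ∀ n, ∑ l ∈ range N, K n l ≤ 1) {w t : ℕ → ℝ} (hw0 : ∀ n, 0 ≤ w n) (hanti : ∀ n, w (n + 1) ≤ w n)
    (htail : ∀ n, N < n → t n = 0) (hrec : ∀ n, t n = w n - R t n) : ∀ n, 0 ≤ t n ∧ t n ≤ w n :=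
  sol_nonneg_le_of_supersol hR hK hw0 (read_le_self_of_antitone hR hK hrow hw0 hanti) htail hrec

/-! ## §3 Comparison composes over age groups: the two-kernel Neumann factorisation -/

/-- A sum of two reads is a read (kernel `KO + Ky`). [folklore] -/
theorem read_add (hRO : ∀ v n, RO v n = ∑ l ∈ range N, KO n l * v (n + 1 + l))
    (hRy : ∀ v n, Ry v n = ∑ l ∈ range N, Ky n l * v (n + 1 + l)) :
    ∀ v n, (fun u m => RO u m + Ry u m) v n = ∑ l ∈ range N, (fun m l => KO m l + Ky m l) n l * v (n + 1 + l) := by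
  intro v n
  simp only [hRO, hRy, ← sum_add_distrib, add_mul]

/-- **THE TWO-KERNEL NEUMANN FACTORISATION (exact expansion).**  Two non-negative... (no sign needed here) kernels `KO`, `Ky` on the horizon `N` with
read operators `RO`, `Ry` and triangular solution operators `SO`, `Sy` (`SO w` = the zero-tailed solution of `v = w − RO v`, `Sy` likewise); an input `e`
with zero tail; the ITERATES `W 0 = e`, `W (i+1) = RO (Ry (Sy (SO (W i))))` (old system solved first, then the young one, then the young drops of the
result read by the old kernel become the next input).  Then the zero-tailed solution `ε` of the FULL system `ε = e − RO ε − Ry ε` is the FINITE sum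
`ε = Σ_{i ≤ N} Sy (SO (W i))` (the supports shrink by two depths per round).  Matrix form: `(I + K_O + K_y)⁻¹ = Σ_i (R_y R_O K_O K_y)^i R_y R_O`.
[folklore] -/
theorem eq_sum_of_age_composition
    (hRO : ∀ v n, RO v n = ∑ l ∈ range N, KO n l * v (n + 1 + l))
    (hRy : ∀ v n, Ry v n = ∑ l ∈ range N, Ky n l * v (n + 1 + l))
    (hSO : ∀ w : ℕ → ℝ, (∀ n, N < n → w n = 0) → (∀ n, N < n → SO w n = 0) ∧ ∀ n, SO w n = w n - RO (SO w) n)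
    (hSy : ∀ w : ℕ → ℝ, (∀ n, N < n → w n = 0) → (∀ n, N < n → Sy w n = 0) ∧ ∀ n, Sy w n = w n - Ry (Sy w) n)
    {e : ℕ → ℝ} (he : ∀ n, N < n → e n = 0)
    {W : ℕ → ℕ → ℝ} (hW0 : W 0 = e) (hWsucc : ∀ i, W (i + 1) = RO (Ry (Sy (SO (W i)))))
    {ε : ℕ → ℝ} (hεtail : ∀ n, N < n → ε n = 0) (hεrec : ∀ n, ε n = e n - RO ε n - Ry ε n) :
    ∀ n, ε n = ∑ i ∈ range (N + 1), Sy (SO (W i)) n := by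
  -- supports: `W i`, `SO (W i)`, `Sy (SO (W i))` vanish at the depths `n` with `N < n + 2i`
  have hsupp : ∀ i, (∀ n, N < n + 2 * i → W i n = 0) ∧ (∀ n, N < n + 2 * i → SO (W i) n = 0) ∧
      (∀ n, N < n + 2 * i → Sy (SO (W i)) n = 0) := by
    intro i
    induction i with
    | zero =>
      have hW : ∀ n, N < n + 2 * 0 → W 0 n = 0 := fun n hn => by rw [hW0]; exact he n (by simpa using hn)
      have hV := sol_eq_zero_of_tail hRO (hSO (W 0) fun n hn => hW n (by simpa using hn)).1 (hSO (W 0) fun n hn => hW n (by simpa using hn)).2 hW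
      have hT := sol_eq_zero_of_tail hRy (hSy _ fun n hn => hV n (by simpa using hn)).1 (hSy _ fun n hn => hV n (by simpa using hn)).2 hV
      exact ⟨hW, hV, hT⟩
    | succ i ih =>
      obtain ⟨_, _, hT⟩ := ih
      have h1 := read_eq_zero_of_tail hRy hT
      have h2 := read_eq_zero_of_tail hRO h1
      have hW : ∀ n, N < n + 2 * (i + 1) → W (i + 1) n = 0 := fun n hn => by
        rw [hWsucc]; exact h2 n (by omega)
      have hWt : ∀ n, N < n → W (i + 1) n = 0 := fun n hn => hW n (by omega)
      have hV := sol_eq_zero_of_tail hRO (hSO _ hWt).1 (hSO _ hWt).2 hW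
      have hVt : ∀ n, N < n → SO (W (i + 1)) n = 0 := fun n hn => hV n (by omega)
      have hT' := sol_eq_zero_of_tail hRy (hSy _ hVt).1 (hSy _ hVt).2 hV
      exact ⟨hW, hV, hT'⟩
  have hWt : ∀ i n, N < n → W i n = 0 := fun i n hn => (hsupp i).1 n (by omega)
  have hVt : ∀ i n, N < n → SO (W i) n = 0 := fun i n hn => (hsupp i).2.1 n (by omega)
  have hTt : ∀ i n, N < n → Sy (SO (W i)) n = 0 := fun i n hn => (hsupp i).2.2 n (by omega)
  have hVrec : ∀ i n, SO (W i) n = W i n - RO (SO (W i)) n := fun i => (hSO _ (hWt i)).2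
  have hTrec : ∀ i n, Sy (SO (W i)) n = SO (W i) n - Ry (Sy (SO (W i))) n := fun i => (hSy _ (hVt i)).2
  -- the candidate `S = Σ_{i ≤ N} T i` solves the full system
  set S : ℕ → ℝ := fun n => ∑ i ∈ range (N + 1), Sy (SO (W i)) n with hS
  have hStail : ∀ n, N < n → S n = 0 := fun n hn => by
    simp only [hS]; exact sum_eq_zero fun i _ => hTt i n hn
  have hSrec : ∀ n, S n = e n - (fun u m => RO u m + Ry u m) S n := by
    intro n
    simp only [hS]
    rw [read_sum hRO, read_sum hRy]
    -- Σ T = Σ (W − RO V − Ry T) and RO V − RO T = RO (Ry T) = W (i+1)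
    have hstep : ∀ i, Sy (SO (W i)) n = (W i n - W (i + 1) n) - RO (Sy (SO (W i))) n - Ry (Sy (SO (W i))) n := by
      intro i
      have e1 : RO (SO (W i)) n - RO (Sy (SO (W i))) n = W (i + 1) n := by
        rw [← read_sub hRO, hWsucc]
        have : (fun m => SO (W i) m - Sy (SO (W i)) m) = Ry (Sy (SO (W i))) := by
          funext m; linarith [hTrec i m]
        rw [this]
      linarith [hVrec i n, hTrec i n]
    rw [sum_congr rfl fun i _ => hstep i, sum_sub_distrib, sum_sub_distrib, Finset.sum_range_sub', hW0,
      (hsupp (N + 1)).1 n (by omega)]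
    ring
  -- uniqueness of the zero-tailed solution of the full system
  have hεrec' : ∀ n, ε n = e n - (fun u m => RO u m + Ry u m) ε n := fun n => by simp only; linarith [hεrec n]
  exact sol_unique (read_add hRO hRy) hεtail hεrec' hStail hSrec

/-- **COMPARISON COMPOSES OVER AGE GROUPS.**  In the setting of `eq_sum_of_age_composition` let both kernels be NON-NEGATIVE and let `A` be a class of inputs
containing `e` such that for every zero-tailed input `w ∈ A`: the old solution `v = SO w` is NON-NEGATIVE, it is a SUPERSOLUTION for the young kernel
(`Ry v ≤ v` at every pin — the KEY inequality «old surplus at the pin ≥ young reads of the old surplus»), and the old reads of the young drops of the young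
solution, `RO (Ry (Sy v))`, lie in `A` again.  Then the solution `ε` of the full system is NON-NEGATIVE at every depth, and the old-first factorisation is a
LOWER BOUND: `ε ≥ Sy (SO e)`.  (Every Neumann term `Sy (SO (W i))` is non-negative by `sol_nonneg_le_of_supersol`.) [folklore] -/
theorem nonneg_of_age_composition
    (hRO : ∀ v n, RO v n = ∑ l ∈ range N, KO n l * v (n + 1 + l))
    (hRy : ∀ v n, Ry v n = ∑ l ∈ range N, Ky n l * v (n + 1 + l)) (hKy : ∀ n l, 0 ≤ Ky n l)
    (hSO : ∀ w : ℕ → ℝ, (∀ n, N < n → w n = 0) → (∀ n, N < n → SO w n = 0) ∧ ∀ n, SO w n = w n - RO (SO w) n)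
    (hSy : ∀ w : ℕ → ℝ, (∀ n, N < n → w n = 0) → (∀ n, N < n → Sy w n = 0) ∧ ∀ n, Sy w n = w n - Ry (Sy w) n)
    {A : (ℕ → ℝ) → Prop} {e : ℕ → ℝ} (he : ∀ n, N < n → e n = 0) (hAe : A e)
    (hA : ∀ w : ℕ → ℝ, A w → (∀ n, N < n → w n = 0) →
      (∀ n, 0 ≤ SO w n) ∧ (∀ n, Ry (SO w) n ≤ SO w n) ∧ A (RO (Ry (Sy (SO w)))))
    {ε : ℕ → ℝ} (hεtail : ∀ n, N < n → ε n = 0) (hεrec : ∀ n, ε n = e n - RO ε n - Ry ε n) :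
    ∀ n, 0 ≤ ε n ∧ Sy (SO e) n ≤ ε n := by
  let W : ℕ → ℕ → ℝ := fun i => Nat.rec (motive := fun _ => ℕ → ℝ) e (fun _ w => RO (Ry (Sy (SO w)))) i
  have hW0 : W 0 = e := rfl
  have hWsucc : ∀ i, W (i + 1) = RO (Ry (Sy (SO (W i)))) := fun i => rfl
  have hexp := eq_sum_of_age_composition hRO hRy hSO hSy he hW0 hWsucc hεtail hεrec
  -- every input `W i` is zero-tailed and in the class `A`
  have hcls : ∀ i, A (W i) ∧ ∀ n, N < n → W i n = 0 := by
    intro i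
    induction i with
    | zero => exact ⟨hW0 ▸ hAe, fun n hn => by rw [hW0]; exact he n hn⟩
    | succ i ih =>
      obtain ⟨hAi, hti⟩ := ih
      refine ⟨by rw [hWsucc]; exact (hA _ hAi hti).2.2, fun n hn => ?_⟩
      rw [hWsucc]
      have hVt := (hSO _ hti).1
      have hTt := (hSy _ hVt).1
      have h1 := read_eq_zero_of_tail (c := 0) hRy (fun m hm => hTt m (by simpa using hm))
      exact read_eq_zero_of_tail hRO h1 n (by omega)
  -- every Neumann term is non-negative
  have hT : ∀ i n, 0 ≤ Sy (SO (W i)) n := by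
    intro i
    obtain ⟨hAi, hti⟩ := hcls i
    obtain ⟨hV0, hVsup, _⟩ := hA _ hAi hti
    have hVt := (hSO _ hti).1
    exact fun n => (sol_nonneg_le_of_supersol hRy hKy hV0 hVsup (hSy _ hVt).1 (hSy _ hVt).2 n).1
  intro n
  rw [hexp n, sum_range_succ']
  refine ⟨add_nonneg (sum_nonneg fun i _ => hT (i + 1) n) (hT 0 n), ?_⟩
  have : Sy (SO e) n = Sy (SO (W 0)) n := by rw [hW0]
  rw [this]
  linarith [sum_nonneg fun i (_ : i ∈ range N) => hT (i + 1) n]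


/-! ## §4 The concrete class: non-increasing inputs -/

/-- **COMPARISON COMPOSES OVER AGE GROUPS, for the class of NON-INCREASING inputs.**  `nonneg_of_age_composition` with `A` = «non-negative and non-increasing
in the depth»: if the old solution operator maps every non-increasing non-negative zero-tailed input `w` to a NON-NEGATIVE `v = SO w` that is a supersolution
of the young kernel (`Ry v ≤ v`, KEY) and whose image `RO (Ry (Sy v))` (old reads of the young drops of the young solution) is again non-negative and
non-increasing (MONO), then for every non-increasing non-negative zero-tailed excess `e` the solution of the full system is non-negative and at least the
old-first factorisation `Sy (SO e)`.  With `sol_nonneg_le_of_antitone` (a lone age) as the base this is the induction step over the ages of a profile,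
youngest added last. [folklore] -/
theorem nonneg_of_age_composition_antitone
    (hRO : ∀ v n, RO v n = ∑ l ∈ range N, KO n l * v (n + 1 + l))
    (hRy : ∀ v n, Ry v n = ∑ l ∈ range N, Ky n l * v (n + 1 + l)) (hKy : ∀ n l, 0 ≤ Ky n l)
    (hSO : ∀ w : ℕ → ℝ, (∀ n, N < n → w n = 0) → (∀ n, N < n → SO w n = 0) ∧ ∀ n, SO w n = w n - RO (SO w) n)
    (hSy : ∀ w : ℕ → ℝ, (∀ n, N < n → w n = 0) → (∀ n, N < n → Sy w n = 0) ∧ ∀ n, Sy w n = w n - Ry (Sy w) n)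
    (hP : ∀ w : ℕ → ℝ, (∀ n, 0 ≤ w n) → (∀ n, w (n + 1) ≤ w n) → (∀ n, N < n → w n = 0) →
      (∀ n, 0 ≤ SO w n) ∧ (∀ n, Ry (SO w) n ≤ SO w n) ∧
      (∀ n, 0 ≤ RO (Ry (Sy (SO w))) n) ∧ (∀ n, RO (Ry (Sy (SO w))) (n + 1) ≤ RO (Ry (Sy (SO w))) n))
    {e : ℕ → ℝ} (he0 : ∀ n, 0 ≤ e n) (hea : ∀ n, e (n + 1) ≤ e n) (he : ∀ n, N < n → e n = 0)
    {ε : ℕ → ℝ} (hεtail : ∀ n, N < n → ε n = 0) (hεrec : ∀ n, ε n = e n - RO ε n - Ry ε n) :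
    ∀ n, 0 ≤ ε n ∧ Sy (SO e) n ≤ ε n :=
  nonneg_of_age_composition (A := fun w => (∀ n, 0 ≤ w n) ∧ ∀ n, w (n + 1) ≤ w n) hRO hRy hKy hSO hSy he ⟨he0, hea⟩
    (fun w hw ht => by
      obtain ⟨h1, h2, h3, h4⟩ := hP w hw.1 hw.2 ht
      exact ⟨h1, h2, h3, h4⟩)
    hεtail hεrec

end Summit.QuantumFields.BalabanUV.Beta.EriceRemainderEnclosureHistoryAutonomyComparisonAgeComposition

end
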